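import Summits.HubbardSuperconductivity.HubbardSuperconductivity.Theorems.AnisotropyChordTransferFibre3KappaZero
import Summits.HubbardSuperconductivity.HubbardSuperconductivity.Theorems.AnisotropyChordTransferFibre3DenMinRestLattice

/-!
# Route `AnisotropyChord` / H0 rotor rung: the GM₃ assemblies with the closed-form rest denominator `ρ = 2 + cos θ`

With `denMinRest_closedForm` (`…Fibre3DenMinRestLattice`: `8 ≤ L → Δ ≤ 1 → DenMinRest L Δ (2 + cos(2π/L))`) the `DenMinRest ρ`
hypothesis of the two assemblies `gm3_of_cruxes_secondGap` (`…Fibre3KappaZero`) and `gm3_of_cruxes_smallDelta`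
(`…Fibre3KTAssemblySmallDelta`) is discharged at `ρ = 2 + cos θ` (theory seat `hubbard-h0-rotor-theory-1`, memo 21 §306/§309):
* **`gm3_closedRho_secondGap`**: `8 ≤ L`, `0 < Δ < 1`, `SecondGapK1 L (ε₁cos2theta/2)`, a ground profile with `T⁺ < 2ε₁`, `0 ≤ m`,
  `fac·η_eff·(a + b/(2+cos θ)) < c`, and the three cruxes `TrialGapAbs c`, `LowShellGFormAbs a`, `OffPoleTailAbs b` ⇒ `GM3Fibre L Δ`;
* **`gm3_closedRho_smallDelta`**: the same without `SecondGapK1`/`m` when `Δκ_E < 1`, side condition `η_eff(a + b/(2+cos θ))/(1 − Δκ_E) < c`;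
* **`offPoleTailFromPieces_of_pairSplit`**: `PairSplitCS L Δ → OffPoleTailFromPieces L Δ` (with `nTermBound_holds`: `√‖N‖² ≤ 3√‖C0′‖²`).
Prover seat `hubbard-h0-rotor-p1` g22; helper for stmt-HubbardSuperconductivity-19089 (`--supports`).
-/

set_option linter.dupNamespace false
set_option autoImplicit false

noncomputable section

open scoped BigOperators
open Complex

namespace Summit.HubbardSuperconductivity.HubbardSuperconductivity.Theorems.AnisotropyChord.Transfer.Fibre3

variable (L : ℕ) [NeZero L]

omit [NeZero L] in
/-- `0 < 2 + cos(2π/L)`. [folklore] -/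
theorem two_add_cos_pos : 0 < 2 + Real.cos (2 * Real.pi / L) := by
  linarith [Real.neg_one_le_cos (2 * Real.pi / L)]

/-- **GM₃ from the three cruxes + THEOREM G2 + the regime facts, with `ρ = 2 + cos θ` discharged** (`8 ≤ L`). [folklore] -/
theorem gm3_closedRho_secondGap (hL : 8 ≤ L) {Δ : ℝ} (hΔ0 : 0 < Δ) (hΔ1 : Δ < 1) (c a b : ℝ)
    (hSG : SecondGapK1 L (eps1 L * cos2theta L / 2))
    {lam2 : ℝ} {f : Tor L → ℝ} (hf : IsGroundTwoMagnon L Δ lam2 f) (hT2 : Tplus L Δ f < 2 * eps1 L)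
    (hm : 0 ≤ mHole L Δ f)
    (hside : facMI L Δ f * etaEff L lam2 * (a + b / (2 + Real.cos (2 * Real.pi / L))) < c)
    (hKT1 : TrialGapAbs L Δ c) (hKT2a : LowShellGFormAbs L Δ a) (hKT2b : OffPoleTailAbs L Δ b) : GM3Fibre L Δ :=
  gm3_of_cruxes_secondGap L (by omega) hΔ0 hΔ1 c a b (two_add_cos_pos L) hSG hf hT2 hm hside hKT1 hKT2a hKT2b
    (denMinRest_closedForm L hL hΔ1.le)

/-- **GM₃ from the three cruxes for `Δκ_E < 1` (no second-gap input), with `ρ = 2 + cos θ` discharged** (`8 ≤ L`). [folklore] -/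
theorem gm3_closedRho_smallDelta (hL : 8 ≤ L) {Δ : ℝ} (hΔ0 : 0 < Δ) (hΔ1 : Δ < 1) (c a b : ℝ)
    {lam2 : ℝ} {f : Tor L → ℝ} (hf : IsGroundTwoMagnon L Δ lam2 f) (hT2 : Tplus L Δ f < 2 * eps1 L)
    (hsmall : Δ * kappaE L Δ f < 1)
    (hside : etaEff L lam2 * (a + b / (2 + Real.cos (2 * Real.pi / L))) / (1 - Δ * kappaE L Δ f) < c)
    (hKT1 : TrialGapAbs L Δ c) (hKT2a : LowShellGFormAbs L Δ a) (hKT2b : OffPoleTailAbs L Δ b) : GM3Fibre L Δ :=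
  gm3_of_cruxes_smallDelta L (by omega) hΔ0 hΔ1 c a b (two_add_cos_pos L) hf hT2 hsmall hside hKT1 hKT2a hKT2b
    (denMinRest_closedForm L hL hΔ1.le)

/-! ## `OffPoleTailFromPieces` from `PairSplitCS` -/

/-- `√‖N‖² ≤ 3 √‖C0′‖²` (from `nTermBound_holds`). [folklore] -/
theorem sqrt_nNterm_le (Δ : ℝ) (f : Tor L → ℝ) :
    Real.sqrt (nNterm L Δ f) ≤ 3 * Real.sqrt (nC0p L Δ f) := by
  have h := nTermBound_holds L Δ f
  have h9 : Real.sqrt (9 * nC0p L Δ f) = 3 * Real.sqrt (nC0p L Δ f) := by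
    rw [Real.sqrt_mul (by norm_num), show Real.sqrt 9 = 3 by
      rw [show (9 : ℝ) = 3 ^ 2 by norm_num, Real.sqrt_sq (by norm_num)]]
  rw [← h9]
  exact Real.sqrt_le_sqrt h

/-- **`PairSplitCS ⇒ OffPoleTailFromPieces`** (monotonicity of `(3√cs2 + t)²` in `t ≥ 0`). [folklore] -/
theorem offPoleTailFromPieces_of_pairSplit (Δ : ℝ) (h : PairSplitCS L Δ) : OffPoleTailFromPieces L Δ := by
  intro lam2 f hf hsym
  have h1 := h lam2 f hf hsym
  have hs := sqrt_nNterm_le L Δ f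
  have h0 : 0 ≤ Real.sqrt (nNterm L Δ f) := Real.sqrt_nonneg _
  have hA : 0 ≤ 3 * Real.sqrt (cs2 L f) := by positivity
  have hsq : (3 * Real.sqrt (cs2 L f) + Real.sqrt (nNterm L Δ f)) ^ 2
      ≤ (3 * Real.sqrt (cs2 L f) + 3 * Real.sqrt (nC0p L Δ f)) ^ 2 := by
    nlinarith [mul_nonneg (sub_nonneg.2 hs) (by linarith : 0 ≤ 2 * (3 * Real.sqrt (cs2 L f))
      + 3 * Real.sqrt (nC0p L Δ f) + Real.sqrt (nNterm L Δ f))]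
  linarith

end Summit.HubbardSuperconductivity.HubbardSuperconductivity.Theorems.AnisotropyChord.Transfer.Fibre3

end
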